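import Literature.Topology.FourManifolds.SmoothHomologicalOrientationProofs
import Literature.Topology.FourManifolds.SpinDiffeomorphProofs
import HarnessLib

/-!
# Compatible homological orientations are natural under orientation-preserving local diffeomorphisms

G. E. Bredon, *Topology and Geometry* (1993), VI.7, Prop. 7.14 / Thm. 7.15: the dictionary between
smooth orientations and homological `ℤ`-orientations of a smooth manifold — in the tree,
`SmoothOrientation.IsCompatible g o μ` (`SmoothHomologicalOrientation.lean`; existence and
uniqueness of the compatible `μ`: `SmoothOrientation.existsUnique_isCompatible_holds`). This file
proves that the dictionary is **natural**: an orientation-preserving local diffeomorphism carries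
compatible local classes to compatible local classes (Bredon VI.7, proof of Thm. 7.15: "a
diffeomorphism acts on `Hₙ(ℝⁿ, ℝⁿ - 0)` by the sign of its Jacobian"; Milnor–Stasheff 1974,
App. A, p. 123).

* `SmoothOrientation.map_localClass_eq_of_isCompatibleAt` — for `f : M → N` of class `C¹` and
  injective, with invertible differential at `x`, orientation preserving at `x`
  (`oN (f x) = oM x ↔ 0 < det (mfderiv f x)`), and `μM`, `μN` compatible with `oM`, `oN` at `x`,
  `f x`: `f_* (μM)ₓ = (μN)_{f x}` in `Hₙ(N | f x; ℤ)`;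
* `SmoothOrientation.IsCompatible.map_localClass_eq` — the global form for
  `IsOrientationPreserving oM oN f`;
* `SmoothOrientation.IsCompatible.comap_diffeomorph` — for an orientation-preserving
  diffeomorphism `φ : M ≅ N` and `μN` compatible with `oN`, the transported orientation
  `μN.comap φ` is compatible with `oM`.

The proof is the tree's change-of-chart computation (`compatClass_eq_smul_fixedChartClass`,
`SmoothHomologicalOrientationProofs.lean`) with the chart transition replaced by
`t = φ_{f x} ∘ f ∘ φₓ⁻¹`, which acts on the local orientation class of `ℝⁿ` by the sign of its
Jacobian (`HomologicalOrientation.localDegree_of_hasFDerivAt`, `…LocalDegreeLinearization`).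
Everything is proved; no named facts.

## References

* G. E. Bredon, *Topology and Geometry*, GTM 139, Springer 1993, VI.7 Prop. 7.14, Thm. 7.15.
  [Bredon1993]
* J. Milnor, J. Stasheff, *Characteristic Classes*, PUP 1974, Appendix A pp. 122–123.
  [MilnorStasheff1974]
-/

open scoped Manifold ContDiff Topology
open Set Function CategoryTheory Module Metric
open Literature.AlgebraicTopology.SingularHomology

noncomputable section

namespace Literature.Topology.FourManifolds

namespace SmoothOrientation

variable {n : ℕ} {M N : Type} [TopologicalSpace M] [ChartedSpace (EuclideanSpace ℝ (Fin n)) M]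
  [TopologicalSpace N] [ChartedSpace (EuclideanSpace ℝ (Fin n)) N]

/-! ### Sign bookkeeping for two orientation values -/

variable [IsManifold (𝓡 n) 1 M] [IsManifold (𝓡 n) 1 N]

/-- Signs at two points of two oriented manifolds whose orientation values are compared by `s`:
if `s = 1 ↔ oN y = oM x` then `ε_y s = εₓ` (the model space has exactly the two orientations `± e`;
as `signAt_mul_eq_signAt`, for two manifolds). [folklore] -/
theorem signAt_mul_eq_signAt₂ {oM : SmoothOrientation (𝓡 n) M} {oN : SmoothOrientation (𝓡 n) N}
    {x : M} {y : N} {s : ℤˣ} (h : s = 1 ↔ oN y = oM x) :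
    signAt oN y * s = signAt oM x := by
  have two := fun a b : Orientation ℝ (EuclideanSpace ℝ (Fin n)) (Fin (finrank ℝ (EuclideanSpace ℝ (Fin n)))) =>
    Orientation.eq_or_eq_neg a b (by simp)
  have hne : ∀ a : Orientation ℝ (EuclideanSpace ℝ (Fin n)) (Fin (finrank ℝ (EuclideanSpace ℝ (Fin n)))), a ≠ -a :=
    fun a => Module.Ray.ne_neg_self a
  rcases Int.units_eq_one_or s with rfl | rfl
  · have hy : oN y = oM x := h.1 rfl
    rw [mul_one]
    unfold signAt
    rw [hy]
  · have hy : oN y ≠ oM x := fun e => absurd (h.2 e) (by decide)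
    have hy' : oN y = -oM x := (two (oN y) (oM x)).resolve_left hy
    rw [mul_neg, mul_one]
    unfold signAt
    by_cases hx : oM x = euclideanOrientation n
    · have hny : ¬ oN y = euclideanOrientation n := by
        rw [hy', hx]
        exact fun e => hne _ e.symm
      rw [if_pos hx, if_neg hny]
      exact neg_neg 1
    · have hx' : oM x = -euclideanOrientation n :=
        (two (oM x) (euclideanOrientation n)).resolve_left hx
      have hye : oN y = euclideanOrientation n := by
        rw [hy', hx']
        exact neg_neg (euclideanOrientation n)
      rw [if_neg hx, if_pos hye]

/-! ### The written-out map `t = φ_{f x} ∘ f ∘ φₓ⁻¹` and its derivative -/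

omit [IsManifold (𝓡 n) 1 M] [IsManifold (𝓡 n) 1 N] in
/-- For the boundaryless model `𝓡 n`, the derivative `mfderiv f x` is the Fréchet derivative of
`φ_{f x} ∘ f ∘ φₓ⁻¹` at `φₓ x` (Mathlib's `HasMFDerivAt`, unfolded). [folklore] -/
theorem hasFDerivAt_writtenInCharts {f : M → N} {x : M} (hf : MDifferentiableAt (𝓡 n) (𝓡 n) f x) :
    HasFDerivAt ((chartAt (EuclideanSpace ℝ (Fin n)) (f x)) ∘ f ∘ (chartAt (EuclideanSpace ℝ (Fin n)) x).symm)
      (mfderiv (𝓡 n) (𝓡 n) f x) (chartAt (EuclideanSpace ℝ (Fin n)) x x) := by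
  have hd := hf.hasMFDerivAt.2
  rw [ModelWithCorners.Boundaryless.range_eq_univ, hasFDerivWithinAt_univ] at hd
  have e₁ : writtenInExtChartAt (𝓡 n) (𝓡 n) x f =
      (chartAt (EuclideanSpace ℝ (Fin n)) (f x)) ∘ f ∘ (chartAt (EuclideanSpace ℝ (Fin n)) x).symm := by
    funext v
    simp only [writtenInExtChartAt, extChartAt_coe, extChartAt_coe_symm, modelWithCornersSelf_coe,
      modelWithCornersSelf_coe_symm, Function.comp_apply, id_eq]
  have e₂ : extChartAt (𝓡 n) x x = chartAt (EuclideanSpace ℝ (Fin n)) x x := by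
    simp only [extChartAt_coe, modelWithCornersSelf_coe, Function.comp_apply, id_eq]
  rwa [e₁, e₂] at hd

variable [T2Space M]

/-! ### The main computation -/

/-- **An orientation-preserving `C¹` local diffeomorphism carries compatible local classes to
compatible local classes** (Bredon 1993, VI.7, Thm. 7.15 and its proof). Let `f : M → N` be
injective and continuous, differentiable at `x` with `det (mfderiv f x) ≠ 0`, orientation
preserving at `x` for the smooth orientations `oM`, `oN` (`oN (f x) = oM x ↔ 0 < det (mfderiv f x)`,
the pointwise clause of `IsOrientationPreserving`), and let `μM`, `μN` be homological orientations
compatible with `oM` at `x` and with `oN` at `f x` (same generator convention `g`). Then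
`f_* (μM)ₓ = (μN)_{f x}`. [cite: Bredon1993, VI.7 Thm. 7.15 (proof)] -/
theorem map_localClass_eq_of_isCompatibleAt (g : HomologicalOrientation ℤ (EuclideanSpace ℝ (Fin n)) n)
    {oM : SmoothOrientation (𝓡 n) M} {oN : SmoothOrientation (𝓡 n) N}
    {μM : HomologicalOrientation ℤ M n} {μN : HomologicalOrientation ℤ N n}
    {f : M → N} (hfc : Continuous f) (hfi : Injective f) {x : M}
    (hfd : MDifferentiableAt (𝓡 n) (𝓡 n) f x)
    (hdet : LinearMap.det (M := EuclideanSpace ℝ (Fin n)) (mfderiv (𝓡 n) (𝓡 n) f x).toLinearMap ≠ 0)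
    (hop : oN (f x) = oM x ↔
      0 < LinearMap.det (M := EuclideanSpace ℝ (Fin n)) (mfderiv (𝓡 n) (𝓡 n) f x).toLinearMap)
    (hM : IsCompatibleAt g oM μM x) (hN : IsCompatibleAt g oN μN (f x)) :
    relativeSingularHomology.map ℤ ℤ ⟨f, hfc⟩ (mapsTo_compl_singleton_of_injective hfi rfl) n
        (μM.localClass x) = μN.localClass (f x) := by
  set φ₀ := chartAt (EuclideanSpace ℝ (Fin n)) x with hφ₀
  set φ := chartAt (EuclideanSpace ℝ (Fin n)) (f x) with hφ
  have hx₀ : x ∈ φ₀.source := mem_chart_source _ x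
  have hyV : f x ∈ φ.source := mem_chart_source _ (f x)
  set t : EuclideanSpace ℝ (Fin n) → EuclideanSpace ℝ (Fin n) := φ ∘ f ∘ φ₀.symm with ht
  set p : EuclideanSpace ℝ (Fin n) := φ₀ x with hp
  set q : EuclideanSpace ℝ (Fin n) := φ (f x) with hq
  have htp : t p = q := by
    change φ (f (φ₀.symm (φ₀ x))) = φ (f x)
    rw [φ₀.left_inv hx₀]
  -- the open set where `t` is a genuine composite of homeomorphisms-onto-open-subsets
  set T : Set (EuclideanSpace ℝ (Fin n)) := φ₀.target ∩ φ₀.symm ⁻¹' (f ⁻¹' φ.source) with hT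
  have hTo : IsOpen T :=
    φ₀.continuousOn_symm.isOpen_inter_preimage φ₀.open_target (φ.open_source.preimage hfc)
  have hpT : p ∈ T := ⟨φ₀.map_source hx₀, by
    change f (φ₀.symm (φ₀ x)) ∈ φ.source; rw [φ₀.left_inv hx₀]; exact hyV⟩
  obtain ⟨r, hr, hball⟩ := Metric.isOpen_iff.1 hTo p hpT
  have hfcT : ContinuousOn t T := by
    refine φ.continuousOn.comp ((hfc.comp_continuousOn φ₀.continuousOn_symm).mono inter_subset_left)
      ?_
    exact fun v hv => hv.2
  have htc : ContinuousOn t (ball p r) := hfcT.mono hball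
  have hti : InjOn t (ball p r) := by
    intro a ha b hb hab
    have ha' := hball ha
    have hb' := hball hb
    have h1 : f (φ₀.symm a) = f (φ₀.symm b) := φ.injOn ha'.2 hb'.2 hab
    have h2 : φ₀.symm a = φ₀.symm b := hfi h1
    exact φ₀.symm.injOn ha'.1 hb'.1 h2
  -- the derivative and its sign
  set L : EuclideanSpace ℝ (Fin n) →L[ℝ] EuclideanSpace ℝ (Fin n) := mfderiv (𝓡 n) (𝓡 n) f x with hL
  have hd : HasFDerivAt t L p := hasFDerivAt_writtenInCharts hfd
  set s : ℤˣ := if 0 < LinearMap.det (L : EuclideanSpace ℝ (Fin n) →ₗ[ℝ] EuclideanSpace ℝ (Fin n))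
    then 1 else -1 with hs
  have hs1 : s = 1 ↔ 0 < LinearMap.det (L : EuclideanSpace ℝ (Fin n) →ₗ[ℝ] EuclideanSpace ℝ (Fin n)) := by
    rw [hs]
    split_ifs with h
    · exact ⟨fun _ => h, fun _ => rfl⟩
    · exact ⟨fun h1 => absurd h1 (by decide), fun h' => absurd h' h⟩
  have hsg : (if 0 < LinearMap.det (L : EuclideanSpace ℝ (Fin n) →ₗ[ℝ] EuclideanSpace ℝ (Fin n))
      then g.localClass q else -g.localClass q) = (s : ℤ) • g.localClass q := by
    rw [hs]
    split_ifs
    · rw [Units.val_one, one_zsmul]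
    · rw [Units.val_neg, Units.val_one, neg_one_zsmul]
  -- `ε_{f x} s = ε_x`
  have hεs : signAt oN (f x) * s = signAt oM x :=
    signAt_mul_eq_signAt₂ (hs1.trans hop.symm)
  -- the hub `W = U₀ ∩ φ₀⁻¹ B(p, r)` (it lies in `f⁻¹ φ.source`)
  set W : Set M := φ₀.source ∩ φ₀ ⁻¹' ball p r with hW
  have hWo : IsOpen W := φ₀.isOpen_inter_preimage isOpen_ball
  have hxW : x ∈ W := ⟨hx₀, mem_ball_self hr⟩
  have hWU : W ⊆ φ₀.source := inter_subset_left
  have hWV : ∀ w ∈ W, f w ∈ φ.source := fun w hw => by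
    have h := (hball hw.2).2
    change f (φ₀.symm (φ₀ w)) ∈ φ.source at h
    rwa [φ₀.left_inv hw.1] at h
  set w₀ : ↥W := ⟨x, hxW⟩ with hw₀
  let jM : C(↥W, M) := subsetIncl W
  let j₀ : C(↥W, ↥φ₀.source) := subsetInclusion hWU
  let jV : C(↥W, ↥φ.source) := ⟨fun w => ⟨f w, hWV w w.2⟩,
    (hfc.comp continuous_subtype_val).subtype_mk _⟩
  let κ : C(↥W, ↥(ball p r)) :=
    ⟨fun w => ⟨φ₀ w, w.2.2⟩, (φ₀.continuousOn.comp_continuous continuous_subtype_val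
      (fun w => w.2.1)).subtype_mk _⟩
  have hκinj : Function.Injective κ := fun a b h => Subtype.ext
    (φ₀.injOn a.2.1 b.2.1 (congrArg (fun z : ↥(ball p r) => (z : EuclideanSpace ℝ (Fin n))) h))
  have hx' : ((κ w₀ : ↥(ball p r)) : EuclideanSpace ℝ (Fin n)) = p := rfl
  let fB : C(↥(ball p r), EuclideanSpace ℝ (Fin n)) := ⟨fun v => t v, htc.restrict⟩
  let fC : C(M, N) := ⟨f, hfc⟩
  -- relations between the maps
  have R1 : (subsetIncl φ₀.source).comp j₀ = jM := rfl
  have R2 : (subsetIncl φ.source).comp jV = fC.comp jM := rfl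
  have R3 : (chartRestrict x).comp j₀ = (subsetIncl (ball p r)).comp κ := rfl
  have R4 : (chartRestrict (f x)).comp jV = fB.comp κ := by
    ext w : 1
    change φ (f w.1) = t (φ₀ w.1)
    change φ (f w.1) = φ (f (φ₀.symm (φ₀ w.1)))
    rw [φ₀.left_inv w.2.1]
  -- `MapsTo` bookkeeping
  have mjM : MapsTo jM ({w₀}ᶜ : Set ↥W) {x}ᶜ :=
    mapsTo_compl_singleton_of_injective Subtype.val_injective rfl
  have mj₀ : MapsTo j₀ ({w₀}ᶜ : Set ↥W) {chartSourcePt x}ᶜ :=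
    mapsTo_compl_singleton_of_injective (inclusion_injective hWU) rfl
  have hjVinj : Function.Injective jV := fun a b h =>
    Subtype.ext (hfi (congrArg (fun z : ↥φ.source => (z : N)) h))
  have mjV : MapsTo jV ({w₀}ᶜ : Set ↥W) {chartSourcePt (f x)}ᶜ :=
    mapsTo_compl_singleton_of_injective hjVinj rfl
  have mκ : MapsTo κ ({w₀}ᶜ : Set ↥W) {κ w₀}ᶜ := mapsTo_compl_singleton_of_injective hκinj rfl
  have mA0 : MapsTo (subsetIncl φ₀.source) ({chartSourcePt x}ᶜ : Set ↥φ₀.source) {x}ᶜ :=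
    mapsTo_compl_singleton_of_injective Subtype.val_injective rfl
  have mB0 : MapsTo (chartRestrict x) ({chartSourcePt x}ᶜ : Set ↥φ₀.source) {p}ᶜ :=
    mapsTo_compl_singleton_of_injective (chartRestrict_injective x) rfl
  have mι : MapsTo (subsetIncl (ball p r)) ({κ w₀}ᶜ : Set ↥(ball p r)) {p}ᶜ :=
    mapsTo_compl_singleton_of_injective Subtype.val_injective hx'
  have m₁ : MapsTo fB ({κ w₀}ᶜ : Set ↥(ball p r)) {q}ᶜ :=
    mapsTo_compl_singleton_of_injective (fun a b h => Subtype.ext (hti a.2 b.2 h)) htp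
  have mf : MapsTo fC ({x}ᶜ : Set M) {f x}ᶜ := mapsTo_compl_singleton_of_injective hfi rfl
  -- isomorphisms at `x`
  haveI iM : IsIso (relativeSingularHomology.map ℤ ℤ jM mjM n) :=
    Literature.AlgebraicTopology.SingularHomology.localHomology.isIso_map_subsetIncl_of_isOpen
      ℤ ℤ hWo hxW n
  haveI iA : IsIso (relativeSingularHomology.map ℤ ℤ (subsetIncl φ₀.source) mA0 n) :=
    Literature.AlgebraicTopology.SingularHomology.localHomology.isIso_map_subsetIncl_of_isOpen
      ℤ ℤ φ₀.open_source hx₀ n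
  haveI ij₀ : IsIso (relativeSingularHomology.map ℤ ℤ j₀ mj₀ n) := by
    have w : relativeSingularHomology.map ℤ ℤ j₀ mj₀ n ≫
        relativeSingularHomology.map ℤ ℤ (subsetIncl φ₀.source) mA0 n =
        relativeSingularHomology.map ℤ ℤ jM mjM n :=
      (relativeSingularHomology.map_comp ℤ ℤ j₀ (subsetIncl φ₀.source) mj₀ mA0 n).symm.trans
        (relativeSingularHomology.map.congr_simp ℤ ℤ _ _ R1 _ n)
    haveI : IsIso (relativeSingularHomology.map ℤ ℤ j₀ mj₀ n ≫
        relativeSingularHomology.map ℤ ℤ (subsetIncl φ₀.source) mA0 n) := by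
      rw [w]; exact iM
    exact IsIso.of_isIso_comp_right (relativeSingularHomology.map ℤ ℤ j₀ mj₀ n)
      (relativeSingularHomology.map ℤ ℤ (subsetIncl φ₀.source) mA0 n)
  haveI iBx := isIso_pushChart (n := n) x n
  haveI iBy := isIso_pushChart (n := n) (f x) n
  -- the classes `d = Bₓ⁻¹ g_p`, `e = (j₀)_*⁻¹ d`, `c = κ_* e`
  set d := inv (pushChart x n) (g.localClass p) with hd'
  clear_value d
  set e := inv (relativeSingularHomology.map ℤ ℤ j₀ mj₀ n) d with he
  clear_value e
  set c := relativeSingularHomology.map ℤ ℤ κ mκ n e with hc'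
  clear_value c
  have hj₀e : relativeSingularHomology.map ℤ ℤ j₀ mj₀ n e = d := by
    rw [he, ← ModuleCat.comp_apply, IsIso.inv_hom_id, ModuleCat.id_apply]
  have hBd : pushChart x n d = g.localClass p := by
    rw [hd', ← ModuleCat.comp_apply, IsIso.inv_hom_id, ModuleCat.id_apply]
  have hBx_eq : pushChart x n = relativeSingularHomology.map ℤ ℤ (chartRestrict x) mB0 n := rfl
  have hc : relativeSingularHomology.map ℤ ℤ (subsetIncl (ball p r)) mι n c = g.localClass p := by
    rw [hc', ← ModuleCat.comp_apply,
      ← relativeSingularHomology.map_comp ℤ ℤ κ (subsetIncl (ball p r)) mκ mι n,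
      ← relativeSingularHomology.map.congr_simp ℤ ℤ _ _ R3 (mB0.comp mj₀) n,
      relativeSingularHomology.map_comp ℤ ℤ j₀ (chartRestrict x) mj₀ mB0 n, ModuleCat.comp_apply,
      hj₀e, ← hBx_eq, hBd]
  -- the local degree theorem: `(fB)_* c = s • g_q`
  have hc2 : c = (Literature.AlgebraicTopology.SingularHomology.localHomology.openSubsetIso ℤ ℤ
      isOpen_ball (κ w₀).2 n).inv (g.localClass p) := by
    have hh : (Literature.AlgebraicTopology.SingularHomology.localHomology.openSubsetIso ℤ ℤ
        isOpen_ball (κ w₀).2 n).hom c = g.localClass p := hc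
    rw [← hh, ← ModuleCat.comp_apply, Iso.hom_inv_id, ModuleCat.id_apply]
  have hD : relativeSingularHomology.map ℤ ℤ fB m₁ n c = (s : ℤ) • g.localClass q := by
    rw [← hsg, hc2]
    exact HomologicalOrientation.localDegree_of_hasFDerivAt g t isOpen_ball (κ w₀).2 htc hd hdet
      htp m₁
  -- `B_{f x} ((j_V)_* e) = s • g_q`
  have hBy : pushChart (f x) n (relativeSingularHomology.map ℤ ℤ jV mjV n e) =
      (s : ℤ) • g.localClass q := by
    rw [← hD, hc', ← ModuleCat.comp_apply, ← ModuleCat.comp_apply]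
    have hm : relativeSingularHomology.map ℤ ℤ jV mjV n ≫ pushChart (f x) n =
        relativeSingularHomology.map ℤ ℤ κ mκ n ≫
          relativeSingularHomology.map ℤ ℤ fB m₁ n := by
      change relativeSingularHomology.map ℤ ℤ jV mjV n ≫
        Literature.AlgebraicTopology.SingularHomology.localHomology.push _ _ _ _ n = _
      rw [Literature.AlgebraicTopology.SingularHomology.localHomology.push_def,
        ← relativeSingularHomology.map_comp, ← relativeSingularHomology.map_comp]
      exact relativeSingularHomology.map.congr_simp ℤ ℤ _ _ R4 _ n
    rw [hm]
  -- `B_{f x}⁻¹ g_q = s • (j_V)_* e`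
  have hinvB : inv (pushChart (f x) n) (g.localClass q) =
      (s : ℤ) • relativeSingularHomology.map ℤ ℤ jV mjV n e := by
    have e1 : relativeSingularHomology.map ℤ ℤ jV mjV n e =
        inv (pushChart (f x) n) ((s : ℤ) • g.localClass q) := by
      rw [← hBy, ← ModuleCat.comp_apply, IsIso.hom_inv_id, ModuleCat.id_apply]
    rw [e1, map_zsmul, smul_smul, ← Units.val_mul, Int.units_mul_self, Units.val_one, one_zsmul]
  -- `(μN)_{f x} = (ε_{fx} s) • f_* ((j_M)_* e)`
  have hμN : μN.localClass (f x) =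
      ((signAt oN (f x) * s : ℤˣ) : ℤ) • relativeSingularHomology.map ℤ ℤ fC mf n
        (relativeSingularHomology.map ℤ ℤ jM mjM n e) := by
    rw [localClass_eq_of_isCompatibleAt hN]
    change pushIncl (f x) n (inv (pushChart (f x) n)
      ((signAt oN (f x) : ℤ) • g.localClass q)) = _
    rw [map_zsmul, hinvB, smul_smul, map_zsmul, Units.val_mul, ← ModuleCat.comp_apply,
      ← ModuleCat.comp_apply]
    have hm : relativeSingularHomology.map ℤ ℤ jV mjV n ≫ pushIncl (f x) n =
        relativeSingularHomology.map ℤ ℤ jM mjM n ≫ relativeSingularHomology.map ℤ ℤ fC mf n := by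
      change relativeSingularHomology.map ℤ ℤ jV mjV n ≫
        Literature.AlgebraicTopology.SingularHomology.localHomology.push _ _ _ _ n = _
      rw [Literature.AlgebraicTopology.SingularHomology.localHomology.push_def,
        ← relativeSingularHomology.map_comp, ← relativeSingularHomology.map_comp]
      exact relativeSingularHomology.map.congr_simp ℤ ℤ _ _ R2 _ n
    rw [hm]
  -- `(μM)ₓ = ε_x • (j_M)_* e`
  have hμM : μM.localClass x = (signAt oM x : ℤ) • relativeSingularHomology.map ℤ ℤ jM mjM n e := by
    rw [localClass_eq_of_isCompatibleAt hM]
    change pushIncl x n (inv (pushChart x n) ((signAt oM x : ℤ) • g.localClass p)) = _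
    rw [map_zsmul, map_zsmul, ← hd', ← hj₀e, ← ModuleCat.comp_apply]
    have hm : relativeSingularHomology.map ℤ ℤ j₀ mj₀ n ≫ pushIncl x n =
        relativeSingularHomology.map ℤ ℤ jM mjM n := by
      change relativeSingularHomology.map ℤ ℤ j₀ mj₀ n ≫
        Literature.AlgebraicTopology.SingularHomology.localHomology.push _ _ _ _ n = _
      rw [Literature.AlgebraicTopology.SingularHomology.localHomology.push_def,
        ← relativeSingularHomology.map_comp]
      exact relativeSingularHomology.map.congr_simp ℤ ℤ _ _ R1 _ n
    rw [hm]
  rw [hμM, map_zsmul, hμN, hεs]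

/-- **Compatible orientations are natural under orientation-preserving `C¹` injective maps with
invertible differentials** (the global form; Bredon 1993, VI.7 Thm. 7.15): if `μM`, `μN` are the
homological orientations compatible with `oM`, `oN` and `f` is orientation preserving
(`IsOrientationPreserving oM oN f`) then `f_* (μM)ₓ = (μN)_{f x}` for every `x`. [cite: Bredon1993, VI.7 Thm. 7.15 (proof)] -/
theorem IsCompatible.map_localClass_eq (g : HomologicalOrientation ℤ (EuclideanSpace ℝ (Fin n)) n)
    {oM : SmoothOrientation (𝓡 n) M} {oN : SmoothOrientation (𝓡 n) N}
    {μM : HomologicalOrientation ℤ M n} {μN : HomologicalOrientation ℤ N n}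
    (hM : IsCompatible g oM μM) (hN : IsCompatible g oN μN)
    {f : M → N} (hfc : Continuous f) (hfi : Injective f)
    (hfd : MDifferentiable (𝓡 n) (𝓡 n) f)
    (hdet : ∀ x, LinearMap.det (M := EuclideanSpace ℝ (Fin n)) (mfderiv (𝓡 n) (𝓡 n) f x).toLinearMap ≠ 0)
    (hop : IsOrientationPreserving oM oN f) (x : M) :
    relativeSingularHomology.map ℤ ℤ ⟨f, hfc⟩ (mapsTo_compl_singleton_of_injective hfi rfl) n
        (μM.localClass x) = μN.localClass (f x) :=
  map_localClass_eq_of_isCompatibleAt g hfc hfi (hfd x) (hdet x) (hop x) (hM x) (hN (f x))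

/-- **Transport of compatible orientations along orientation-preserving diffeomorphisms**
(Bredon 1993, VI.7): if `φ : M ≅ N` is an orientation-preserving diffeomorphism and `μN`
is compatible with `oN`, then `μN.comap φ` (local classes `φ⁻¹_* (μN)_{φ x}`) is compatible with
`oM` — it is the unique `oM`-compatible orientation (`existsUnique_isCompatible_holds`), whose
local classes `φ` carries to those of `μN` (`IsCompatible.map_localClass_eq`). [cite: Bredon1993, VI.7 Thm. 7.15] -/
theorem IsCompatible.comap_diffeomorph (g : HomologicalOrientation ℤ (EuclideanSpace ℝ (Fin n)) n)
    {oM : SmoothOrientation (𝓡 n) M} {oN : SmoothOrientation (𝓡 n) N}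
    {μN : HomologicalOrientation ℤ N n} (hN : IsCompatible g oN μN)
    (φ : M ≃ₘ^1⟮𝓡 n, 𝓡 n⟯ N) (hop : IsOrientationPreserving oM oN φ) :
    IsCompatible g oM (μN.comap φ.toHomeomorph) := by
  obtain ⟨μM, hM, -⟩ := existsUnique_isCompatible_holds (n := n) (M := M) g oM
  suffices h : μN.comap φ.toHomeomorph = μM by rw [h]; exact hM
  ext1
  funext x
  have hdet : ∀ y, LinearMap.det (M := EuclideanSpace ℝ (Fin n))
      (mfderiv (𝓡 n) (𝓡 n) φ y).toLinearMap ≠ 0 := by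
    intro y
    set Lφ : EuclideanSpace ℝ (Fin n) →ₗ[ℝ] EuclideanSpace ℝ (Fin n) :=
      (mfderiv (𝓡 n) (𝓡 n) φ y).toLinearMap with hLφ
    have hinj : Function.Injective Lφ := φ.injective_mfderiv one_ne_zero y
    have hu : IsUnit Lφ := (LinearMap.isUnit_iff_ker_eq_bot _).2 (LinearMap.ker_eq_bot.2 hinj)
    exact ((LinearMap.isUnit_iff_isUnit_det _).1 hu).ne_zero
  have key := IsCompatible.map_localClass_eq g hM hN φ.continuous φ.injective
    (φ.mdifferentiable one_ne_zero) hdet hop x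
  rw [HomologicalOrientation.comap_localClass]
  change (localHomology.mapIso ℤ ℤ φ.toHomeomorph x n).inv (μN.localClass (φ x)) = μM.localClass x
  rw [← key]
  exact (localHomology.mapIso ℤ ℤ φ.toHomeomorph x n).toLinearEquiv.symm_apply_apply (μM.localClass x)

end SmoothOrientation

end Literature.Topology.FourManifolds
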